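import Summits.BirchSwinnertonDyer.BirchSwinnertonDyer.Theses.ShaPrimaryTransfer
import Literature.NumberTheory.EllipticCurves.Zywina2025Torsion
import Literature.NumberTheory.EllipticCurves.Kato2004.ShaFiniteOfOrderLeRankProofs

/-!
# BirchSwinnertonDyer / ShaPrimaryTransfer — crux `FiniteShaComponentTransfer` (stmt-BirchSwinnertonDyer-22356):
# the CROSS-PRIME ROW on Zywina's kernel-certified rank-2 family

The route's cheapest falsifier is the «CROSS-PRIME TABLE»: curves whose door at `2` is decided by 2-descent
(`t_2(E) = corank_{ℤ₂} Ш(E)[2^∞] = 0`) against the `λ`-door of Stein–Wuthrich 2013 at a good ordinary prime `q`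
(`ord_{T=0} L_q(E,T) = rank` certified numerically, whence `Ш(E)[q^∞]` finite by Kato's Thm. 18.4) — the crux
T = `FiniteShaComponentTransfer` predicts agreement wherever both instruments run. On Zywina's family
`E_{m,n} : y² = x³ − 5(m+16n²)x² + 4(m+16n²)(m+25n²)x` (admissible `(m, n)`; D. Zywina, arXiv:2502.01957, Thm. 1.2)
the LEFT column of that table is a THEOREM OF THE TREE — `rank E_{m,n}(ℚ) = 2` and `t_2(E_{m,n}) = 0`
(`Zywina2025.mordellWeilRank_zywinaCurve`, `Zywina2025.shaCorank_two_zywinaCurve`), on a global minimal model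
(`isGloballyMinimal_zywinaCurve`) — so a row of the table needs exactly ONE numerical certificate and ONE
printed theorem. This file states the row (prover seat `bsd-line-spt-p1` g2, `--supports stmt-22356 --as helper`;
companion of `…RankTwoDoor`):

* `crossPrimeRow_zywinaCurve_of_coeff_ne_zero` — at an odd good ordinary prime `q` of `E_{m,n}` with newform `f`,
  granting Kato's Thm. 18.4 at `q` (named fact `kato_selmerCorank_le_order_padicLFunction`), a NON-ZERO
  `T²`-coefficient of `L_q(E_{m,n},T) = padicLFunction f α_q` gives `t_q(E_{m,n}) = 0`,
  `corank_{ℤ_q} Sel_{q^∞}(E_{m,n}/ℚ) = 2` and `ord_{T=0} L_q(E_{m,n},T) = 2`: T's instance `(E_{m,n}, 2, q)`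
  VERIFIED (tree squeeze `finite_sha_primary_of_coeff_padicLFunction_ne_zero` with `n = 2 = rank`, no points
  to exhibit — the rank is a theorem). `…_of_order_le_two`: the same from `ord_{T=0} L_q ≤ 2`.
* `two_le_order_padicLFunction_zywinaCurve` — granting Kato's rank bound at `q`, `2 ≤ ord_{T=0} L_q(E_{m,n},T)`
  always; so, granting Kato, the row closes iff `ord_{T=0} L_q(E_{m,n},T) = 2` (`crossPrimeRow_zywinaCurve_iff_order_eq_two`:
  the `q`-adic BSD rank prediction for this rank-2 curve) — T's instance at `q` FOLLOWS from it and is not known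
  to imply it.
* `transfer_instance_zywinaCurve_of_row` — the agreement statement: where the row closes, T holds at
  `(E_{m,n}, 2, q)` with both sides theorems (modulo Kato + the certificate); T itself predicts the row's
  Selmer column at EVERY `q` (`…RankTwoDoor.selmerCorank_zywinaCurve_of_transfer`).

No row is booked here (no certificate is computed in Lean); nothing here proves T, X1 or BSD.

References: D. Zywina, arXiv:2502.01957 (2025), Thm. 1.2; K. Kato, Astérisque 295 (2004), Thm. 18.4 (p. 281);
W. Stein, C. Wuthrich, Math. Comp. 82 (2013), §10 and Algorithm 11.1 (3); R. Greenberg, LNM 1716 (1999), §1.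
-/

-- D-0017: single-problem summit, so `Summit.BirchSwinnertonDyer.BirchSwinnertonDyer.…` repeats a namespace BY DESIGN.
set_option linter.dupNamespace false

noncomputable section

namespace Summit.BirchSwinnertonDyer.BirchSwinnertonDyer.Theorems.ShaPrimaryTransferCrossPrimeRow

open scoped Classical MatrixGroups ModularForm
open CongruenceSubgroup
open Literature.NumberTheory.EllipticCurves Literature.NumberTheory.EllipticCurves.Zywina2025
  Literature.NumberTheory.EllipticCurves.ModularForms
open WeierstrassCurve
open Summit.BirchSwinnertonDyer.BirchSwinnertonDyer.Theses.ShaPrimaryTransfer (FiniteShaComponentTransfer)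

variable {m n : ℕ} (h : ZywinaAdmissible m n) (q : ℕ) [Fact q.Prime] {N : ℕ} [NeZero N]
  {f : CuspForm (Gamma0 N) 2}
include h

/-! ## The row from a certificate -/

/-- **Cross-prime row on `E_{m,n}` from a non-zero `T²`-coefficient.** Let `(m, n)` be admissible, `q` an odd
prime of good ordinary reduction of (the global minimal model) `E_{m,n}`, `f` its newform, `α_q` the unit root.
Granting Kato's Thm. 18.4 at `q` (named fact `kato_selmerCorank_le_order_padicLFunction`: `corank Sel_{q^∞} ≤
ord_{T=0} L_q`), if the `T²`-coefficient of `L_q(E_{m,n},T)` is non-zero then `Ш(E_{m,n}/ℚ)[q^∞]` is finite,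
`corank_{ℤ_q} Sel_{q^∞}(E_{m,n}/ℚ) = 2`, `t_q(E_{m,n}) = 0` and `ord_{T=0} L_q(E_{m,n},T) = 2` — the rank input
`2 ≤ rank` being Zywina's THEOREM, not exhibited points. CONDITIONAL on `hK` and the certificate `hcoeff`.
[cite: Kato2004Asterisque, Thm. 18.4 (p. 281)] [cite: SteinWuthrich2013, Algorithm 11.1 (3) (p. 27)]
[cite: Zywina2025, Thm 1.2] -/
theorem crossPrimeRow_zywinaCurve_of_coeff_ne_zero [(zywinaCurve m n).IsElliptic]
    [(zywinaCurve m n).IsGloballyMinimal]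
    (hK : kato_selmerCorank_le_order_padicLFunction (zywinaCurve m n) q (f := f))
    (hq : q ≠ 2) (hord : IsOrdinaryAt (zywinaCurve m n) q) (hf : IsNewformOf (zywinaCurve m n) f)
    (hcoeff : PowerSeries.coeff 2 (padicLFunction f (unitRoot (zywinaCurve m n) q : ℚ_[q])) ≠ 0) :
    Finite ↥(AddCommGroup.primaryComponent (zywinaCurve m n).sha q) ∧
      (zywinaCurve m n).selmerCorank q = 2 ∧ (zywinaCurve m n).shaCorank q = 0 ∧
      (padicLFunction f (unitRoot (zywinaCurve m n) q : ℚ_[q])).order = 2 := by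
  obtain ⟨hfin, -, hsel, hsha, hordr⟩ :=
    finite_sha_primary_of_coeff_padicLFunction_ne_zero (zywinaCurve m n) q hK hq hord hf hcoeff
      (by rw [mordellWeilRank_zywinaCurve h])
  exact ⟨hfin, hsel, hsha, by rw [hordr]; rfl⟩

/-- **Cross-prime row on `E_{m,n}` from `ord_{T=0} L_q(E_{m,n},T) ≤ 2`.** Same as
`crossPrimeRow_zywinaCurve_of_coeff_ne_zero` with the certificate in order form (`μ_q = 0 ∧ λ_q = 2` gives it).
CONDITIONAL on `hK`, `hle`. [cite: Kato2004Asterisque, Thm. 18.4 (p. 281)] [cite: SteinWuthrich2013, §10 (p. 26)] -/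
theorem crossPrimeRow_zywinaCurve_of_order_le_two [(zywinaCurve m n).IsElliptic]
    [(zywinaCurve m n).IsGloballyMinimal]
    (hK : kato_selmerCorank_le_order_padicLFunction (zywinaCurve m n) q (f := f))
    (hq : q ≠ 2) (hord : IsOrdinaryAt (zywinaCurve m n) q) (hf : IsNewformOf (zywinaCurve m n) f)
    (hle : (padicLFunction f (unitRoot (zywinaCurve m n) q : ℚ_[q])).order ≤ 2) :
    Finite ↥(AddCommGroup.primaryComponent (zywinaCurve m n).sha q) ∧
      (zywinaCurve m n).selmerCorank q = 2 ∧ (zywinaCurve m n).shaCorank q = 0 ∧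
      (padicLFunction f (unitRoot (zywinaCurve m n) q : ℚ_[q])).order = 2 := by
  have hr := mordellWeilRank_zywinaCurve h
  obtain ⟨hfin, hsel, hsha, hordr⟩ :=
    finite_sha_primary_of_order_padicLFunction_le_mordellWeilRank (zywinaCurve m n) q hK hq hord hf
      (by rw [hr]; exact_mod_cast hle)
  refine ⟨hfin, by rw [hsel, hr], hsha, ?_⟩
  rw [hordr, hr]
  rfl

/-! ## The other inequality: `2 ≤ ord_{T=0} L_q(E_{m,n},T)` from Kato's rank bound -/

/-- Granting Kato's rank bound at `q` (named fact `kato_mordellWeilRank_le_order_padicLFunction`: `rank E(ℚ) ≤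
ord_{T=0} L_q(E,T)`, Thm. 18.4 "in particular"), **`2 ≤ ord_{T=0} L_q(E_{m,n},T)`** at every odd good ordinary
`q`: the `T⁰`- and `T¹`-coefficients of `L_q(E_{m,n},T)` vanish. CONDITIONAL on `hKr`.
[cite: Kato2004Asterisque, Thm. 18.4 (p. 281)] [cite: Zywina2025, Thm 1.2] -/
theorem two_le_order_padicLFunction_zywinaCurve [(zywinaCurve m n).IsElliptic]
    [(zywinaCurve m n).IsGloballyMinimal]
    (hKr : kato_mordellWeilRank_le_order_padicLFunction (zywinaCurve m n) q (f := f))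
    (hq : q ≠ 2) (hord : IsOrdinaryAt (zywinaCurve m n) q) (hf : IsNewformOf (zywinaCurve m n) f) :
    (2 : ℕ∞) ≤ (padicLFunction f (unitRoot (zywinaCurve m n) q : ℚ_[q])).order := by
  have hle := hKr hq hord hf
  rw [mordellWeilRank_zywinaCurve h] at hle
  exact_mod_cast hle

/-- **Granting Kato at `q`, the row closes iff `ord_{T=0} L_q(E_{m,n},T) = 2`** (the `q`-adic BSD rank
prediction for this rank-2 curve): `≤ 2` closes it (`crossPrimeRow_zywinaCurve_of_order_le_two`), and the row's
conclusion contains `= 2`. CONDITIONAL on `hK`. [cite: Kato2004Asterisque, Thm. 18.4 (p. 281)]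
[cite: SteinWuthrich2013, §10 (p. 26)] -/
theorem crossPrimeRow_zywinaCurve_iff_order_eq_two [(zywinaCurve m n).IsElliptic]
    [(zywinaCurve m n).IsGloballyMinimal]
    (hK : kato_selmerCorank_le_order_padicLFunction (zywinaCurve m n) q (f := f))
    (hq : q ≠ 2) (hord : IsOrdinaryAt (zywinaCurve m n) q) (hf : IsNewformOf (zywinaCurve m n) f) :
    ((zywinaCurve m n).shaCorank q = 0 ∧
        (padicLFunction f (unitRoot (zywinaCurve m n) q : ℚ_[q])).order = 2) ↔
      (padicLFunction f (unitRoot (zywinaCurve m n) q : ℚ_[q])).order = 2 := by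
  constructor
  · exact fun hrow => hrow.2
  · intro heq
    obtain ⟨-, -, hsha, hordr⟩ := crossPrimeRow_zywinaCurve_of_order_le_two h q hK hq hord hf heq.le
    exact ⟨hsha, hordr⟩

/-! ## Agreement with the transfer T -/

/-- **Where the row closes, T's instance `(E_{m,n}, 2, q)` holds with both sides theorems**: the hypothesis
`t_2(E_{m,n}) = 0` is Zywina's theorem and the conclusion `t_q(E_{m,n}) = 0` is the row (Kato + certificate).
This is the «agreement of two non-equivalent instruments» the route's falsifier tests, on kernel-certified door
data. CONDITIONAL on `hK`, `hcoeff`. [cite: Kato2004Asterisque, Thm. 18.4 (p. 281)] [cite: Zywina2025, Thm 1.2] -/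
theorem transfer_instance_zywinaCurve_of_row [(zywinaCurve m n).IsElliptic]
    [(zywinaCurve m n).IsGloballyMinimal]
    (hK : kato_selmerCorank_le_order_padicLFunction (zywinaCurve m n) q (f := f))
    (hq : q ≠ 2) (hord : IsOrdinaryAt (zywinaCurve m n) q) (hf : IsNewformOf (zywinaCurve m n) f)
    (hcoeff : PowerSeries.coeff 2 (padicLFunction f (unitRoot (zywinaCurve m n) q : ℚ_[q])) ≠ 0) :
    (zywinaCurve m n).shaCorank 2 = 0 ∧ (zywinaCurve m n).shaCorank q = 0 :=
  ⟨shaCorank_two_zywinaCurve h, (crossPrimeRow_zywinaCurve_of_coeff_ne_zero h q hK hq hord hf hcoeff).2.2.1⟩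

/-- **T predicts the row's Selmer column and, granting Kato, is consistent with its `L_q` column.** Granting T,
`corank_{ℤ_q} Sel_{q^∞}(E_{m,n}/ℚ) = 2` at the odd good ordinary `q` (transfer of the proved `t_2 = 0`), which
is `≤ ord_{T=0} L_q(E_{m,n},T)` by Kato's Thm. 18.4: so T ∧ Kato give `2 ≤ ord_{T=0} L_q` (as the rank bound
does) and leave `ord_{T=0} L_q ≤ 2` — the certificate — as the one thing T does NOT supply.
CONDITIONAL on `hT`, `hK`. [cite: Kato2004Asterisque, Thm. 18.4 (p. 281)] [cite: GreenbergLNM1716, §1 (pp. 54–57)] -/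
theorem selmerCorank_eq_two_and_le_order_of_transfer [(zywinaCurve m n).IsElliptic]
    [(zywinaCurve m n).IsGloballyMinimal] (hT : FiniteShaComponentTransfer)
    (hK : kato_selmerCorank_le_order_padicLFunction (zywinaCurve m n) q (f := f))
    (hq : q ≠ 2) (hord : IsOrdinaryAt (zywinaCurve m n) q) (hf : IsNewformOf (zywinaCurve m n) f) :
    (zywinaCurve m n).selmerCorank q = 2 ∧
      (2 : ℕ∞) ≤ (padicLFunction f (unitRoot (zywinaCurve m n) q : ℚ_[q])).order := by
  have hsha : (zywinaCurve m n).shaCorank q = 0 := hT (zywinaCurve m n) 2 q (shaCorank_two_zywinaCurve h)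
  have hsel : (zywinaCurve m n).selmerCorank q = 2 := by
    rw [(zywinaCurve m n).selmerCorank_eq_mordellWeilRank_add_holds q, mordellWeilRank_zywinaCurve h, hsha]
  refine ⟨hsel, ?_⟩
  have hle := hK hq hord hf
  rw [hsel] at hle
  exact_mod_cast hle

end Summit.BirchSwinnertonDyer.BirchSwinnertonDyer.Theorems.ShaPrimaryTransferCrossPrimeRow
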